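import Summits.ResolutionOfSingularities.ResolutionOfSingularities.Theorems.LassoCutAxisTails
import Summits.ResolutionOfSingularities.ResolutionOfSingularities.Theorems.CornerTowerDescent
import HarnessLib

/-!
# LassoCutCornerTails — two more decided cells of the node «LassoCut»: NO CORNER LASSOS (any chart word) and NO TWO-CHART
CORNER TAILS (§4b–§4c)
(decomp-res node N57, lens-5 g13 `LassoCut.lean` v3 sha256 0f311aface9c0624 = CLEARED v1 a9bc663c + §4b (v2 ADDENDUM, critic
row 80 CLEARED) + §4c (v3 ADDENDUM-2, critic row 82 CLEARED); file 4 of 4, namespace `…Theorems.LassoCut` continued; the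
two-letter descent engine is `Theorems.CornerTowerDescent` (critic (W4): import, not a copy).)

[WRITER NOTE (decomp-res writer g5).  Lens lines :836–:1044 (§4b) and :1224–:1280 (§4c instances) VERBATIM;
the §4c engine
(`twoPot`, `two_letter_descent`, `fin3_*`) and the tree-tower instances (`cornerTower_no_two_letters`, `noCornerTower_two/
_three/_le_three/_le_four_of_four`) live in `Theorems.CornerTowerDescent` and are OPENED here.  Decided cells landed before:
`no_axis_tail` / `no_cornerMonoChart_lasso` (`Theorems.LassoCutAxisTails`).  TREE: the corner cell of `NoLassos` /
`NoAperiodicWalks` (MaxContactCut asides LCNoLassos / LCNoAperiodicWalks, pending) is DECIDED: every lasso cycle translates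
(`Lasso.exists_translation_step`), every corner tail uses all three charts (`corner_tail_uses_all_charts`), and over a finite
field escapes every complexity box (`corner_tail_escapes`); the E-model corner residual = all three charts recurring, no
repeats, every box left (critic rows 80/82).  Resubmission note: lens `degree_fin_three` (unused; =
`Literature.Combinatorics.Extremal.finsuppDegree_fin_three`) and `no_axis_tail_of_twoChart` (same statement as the landed
`no_axis_tail`, of which it was a second proof via `no_twoChart_corner_tail`) are not restated (gate dedup).]

§4b THE SUPPORT GAME of an all-corner segment (`b_t = 0`, charts arbitrary): only the exponent SET matters, the support
cardinality is non-increasing, hence constant around a cycle; the integer CORNER POTENTIAL `Φ_q(m) = |m|² −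
Σᵢ mᵢ² − 2q|m|`
(`cornerPot`) obeys `Φ(λ_j m) = Φ(m) + 2(off_j(m) − q)²` (`cornerPot_chartExponent`): non-decreasing, STRICTLY
increasing on a
`j`-light monomial, and isolation forces a `j_t`-light monomial at every step — so `Σ_{supp} Φ` is non-decreasing, strictly
increasing and periodic around a corner cycle: absurd (`no_corner_lasso`).  Over a finite field the pigeonhole bridge gives
**CORNER TAILS ESCAPE** (`corner_tail_escapes`).  §4c: see the section header.  0 `sorry`.  (Sources: Hauser2010 §§F–G;
BierstoneGrigorievMilmanWlodarczyk2011 §3.)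
-/

open MvPolynomial
open Literature.AlgebraicGeometry.Resolution
open Literature.AlgebraicGeometry.Resolution.Hauser2010
open Literature.AlgebraicGeometry.Resolution.PointBlowup
open Summit.ResolutionOfSingularities.ResolutionOfSingularities.Theorems.TightDefectClasses
open Summit.ResolutionOfSingularities.ResolutionOfSingularities.Theorems.WeakOrderReduction
open Summit.ResolutionOfSingularities.ResolutionOfSingularities.Theorems.ForcedTowerClasses
open Summit.ResolutionOfSingularities.ResolutionOfSingularities.Theorems.CornerTowerDescent

namespace Summit.ResolutionOfSingularities.ResolutionOfSingularities.Theorems.LassoCut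

section CornerTails

variable {K : Type} [Field K] [DecidableEq K]

/-! ### §4b NO CORNER LASSOS — any chart word (the corner potential `Φ = e₂(m) − q·|m|`)

The SUPPORT GAME of an all-corner segment (`b_t = 0`, charts `j_t` arbitrary): only the exponent SET matters —
`supp F_{t+1} = λ_{j_t}(supp F_t)` minus the deleted `q`-th powers, `λ_j` injective in degrees `≥ q` — so the support
cardinality is non-increasing, hence CONSTANT around a cycle (no deletions, `λ` a bijection of supports).  The integer
potential `Φ_q(m) := |m|² − Σᵢmᵢ² − 2q|m|` (`= 2e₂(m) − 2q|m|`) satisfies the exact identity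
`Φ(λ_j m) = Φ(m) + 2(off_j(m) − q)²`: it never decreases and rises STRICTLY on a `j`-light monomial
(`off_j(m) < q`), and isolation of the top locus FORCES a
`j_t`-light monomial at every step (`not_isolatedTop_of_offHeavy`).  Summing `Φ` over the support around the cycle:
`Σ Φ` returns to its value yet strictly increased — contradiction.  CONSEQUENCE: the cycle of every lasso contains a
TRANSLATION step `b_c ≠ 0` (the divergent witness, if any, must leave the corners of the exceptional configuration
inside every period). -/

omit [DecidableEq K] in
/-- The CORNER POTENTIAL `Φ_q(m) = |m|² − Σᵢ mᵢ² − 2q·|m| = 2·(m₀m₁ + m₀m₂ + m₁m₂ −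
q·|m|)` of an exponent (integer
valued; it is twice the elementary symmetric function `e₂(m − (q/2)·𝟙)` up to an additive constant,
`(q/2)·𝟙` being the
common fixed point of the three chart laws).  DEFINITION (support, new here). [folklore] -/
noncomputable def cornerPot (q : ℕ) (m : Fin 3 →₀ ℕ) : ℤ :=
  (m.degree : ℤ) ^ 2 - (∑ i, (m i : ℤ) ^ 2) - 2 * (q : ℤ) * m.degree

/-- KEY IDENTITY: under the `u_j`-chart exponent law at a corner point the potential rises by the SQUARE of the
off-balance, `Φ(λ_j m) = Φ(m) + 2·(off_j(m) − q)²` (`off_j(m) = |m| − m_j`). [folklore] (the lever of this cell) -/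
theorem cornerPot_chartExponent (q : ℕ) (j : Fin 3) {m : Fin 3 →₀ ℕ} (hq : q ≤ m.degree) :
    cornerPot q (chartExponent q j m) = cornerPot q m + 2 * ((m.degree : ℤ) - m j - q) ^ 2 := by
  have hmj : m j ≤ m.degree := by rw [degree_eq_add_sum_erase j m]; exact Nat.le_add_right _ _
  have hd : ((chartExponent q j m j : ℕ) : ℤ) = (m.degree : ℤ) - q := by
    rw [chartExponent_apply, if_pos rfl, Nat.cast_sub hq]
  have herase : ∑ i ∈ Finset.univ.erase j, ((chartExponent q j m i : ℕ) : ℤ) ^ 2 =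
      ∑ i ∈ Finset.univ.erase j, ((m i : ℕ) : ℤ) ^ 2 :=
    Finset.sum_congr rfl fun i hi => by rw [chartExponent_apply, if_neg (Finset.ne_of_mem_erase hi)]
  have hdeg' : ((chartExponent q j m).degree : ℤ) = ((m.degree : ℤ) - q) + ((m.degree : ℤ) - m j) := by
    rw [degree_chartExponent, Nat.cast_add, Nat.cast_sub hq, Nat.cast_sub hmj]
  unfold cornerPot
  rw [← Finset.add_sum_erase _ (fun i => ((chartExponent q j m i : ℕ) : ℤ) ^ 2) (Finset.mem_univ j),
    ← Finset.add_sum_erase _ (fun i => ((m i : ℕ) : ℤ) ^ 2) (Finset.mem_univ j)]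
  rw [herase, hd, hdeg']
  ring

/-- The potential never decreases at a corner step … [folklore] -/
theorem cornerPot_le_chartExponent (q : ℕ) (j : Fin 3) {m : Fin 3 →₀ ℕ} (hq : q ≤ m.degree) :
    cornerPot q m ≤ cornerPot q (chartExponent q j m) := by
  rw [cornerPot_chartExponent q j hq]
  nlinarith [sq_nonneg ((m.degree : ℤ) - m j - q)]

/-- … and rises strictly on a LIGHT monomial (`off_j(m) < q`). [folklore] -/
theorem cornerPot_lt_chartExponent (q : ℕ) (j : Fin 3) {m : Fin 3 →₀ ℕ} (hq : q ≤ m.degree)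
    (hlow : m.degree - m j < q) : cornerPot q m < cornerPot q (chartExponent q j m) := by
  rw [cornerPot_chartExponent q j hq]
  have hmj : m j ≤ m.degree := by rw [degree_eq_add_sum_erase j m]; exact Nat.le_add_right _ _
  have h1 : (m.degree : ℤ) - m j - q ≤ -1 := by
    have : ((m.degree - m j : ℕ) : ℤ) = (m.degree : ℤ) - m j := Nat.cast_sub hmj
    omega
  nlinarith

/-- At a corner step the new support lies in the image of the old one under the chart exponent law. (Sources:
Hauser2010, §F.) -/
theorem support_succ_subset_image {q : ℕ} {s₀ : State (Fin 3) K} (W : ForcedWalk q s₀) (t : ℕ) (hb : W.b (t + 1) = 0) :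
    (W.st (t + 1 + 1)).F.support ⊆ (W.st (t + 1)).F.support.image (chartExponent q (W.j (t + 1))) := by
  classical
  intro m hm
  have hall : ∀ d ∈ (W.st (t + 1)).F.support, q ≤ d.degree := fun d hd => le_degree_of_mem_support_succ W t hd
  rw [MvPolynomial.mem_support_iff, W.st_succ (t + 1)] at hm
  change coeff m (deletePthPowers q (translate (W.b (t + 1)) (chartTransform q (W.j (t + 1)) (W.st (t + 1)).F))) ≠ 0 at hm
  rw [hb, PointBlowup.translate_zero, coeff_deletePthPowers] at hm
  split_ifs at hm with hP
  · exact absurd rfl hm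
  · rw [← HauserPerlega2024.support_chartTransform q _ hall]
    exact MvPolynomial.mem_support_iff.mpr hm

/-- … so the support cardinality never increases at a corner step. (Sources: Hauser2010, §F.) -/
theorem card_support_succ_le {q : ℕ} {s₀ : State (Fin 3) K} (W : ForcedWalk q s₀) (t : ℕ) (hb : W.b (t + 1) = 0) :
    (W.st (t + 1 + 1)).F.support.card ≤ (W.st (t + 1)).F.support.card :=
  (Finset.card_le_card (support_succ_subset_image W t hb)).trans Finset.card_image_le

/-- NO DELETIONS when the cardinality is kept: the new support IS the image, and the potential sum transports.
[folklore] -/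
theorem sum_cornerPot_succ {q : ℕ} {s₀ : State (Fin 3) K} (W : ForcedWalk q s₀) (t : ℕ) (hb : W.b (t + 1) = 0)
    (hcard : (W.st (t + 1)).F.support.card ≤ (W.st (t + 1 + 1)).F.support.card) :
    ∑ m ∈ (W.st (t + 1 + 1)).F.support, cornerPot q m =
      ∑ m ∈ (W.st (t + 1)).F.support, cornerPot q (chartExponent q (W.j (t + 1)) m) := by
  classical
  have hall : ∀ d ∈ (W.st (t + 1)).F.support, q ≤ d.degree := fun d hd => le_degree_of_mem_support_succ W t hd
  have hinj : Set.InjOn (chartExponent q (W.j (t + 1))) (W.st (t + 1)).F.support := fun x hx y hy hxy =>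
    chartExponent_injective (hall x (Finset.mem_coe.mp hx)) (hall y (Finset.mem_coe.mp hy)) hxy
  have heq : (W.st (t + 1 + 1)).F.support = (W.st (t + 1)).F.support.image (chartExponent q (W.j (t + 1))) :=
    Finset.eq_of_subset_of_card_le (support_succ_subset_image W t hb) (Finset.card_image_le.trans hcard)
  rw [heq, Finset.sum_image hinj]

/-- The potential sum never decreases at a deletion-free corner step … [folklore] -/
theorem sum_cornerPot_le_succ {q : ℕ} {s₀ : State (Fin 3) K} (W : ForcedWalk q s₀) (t : ℕ) (hb : W.b (t + 1) = 0)
    (hcard : (W.st (t + 1)).F.support.card ≤ (W.st (t + 1 + 1)).F.support.card) :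
    ∑ m ∈ (W.st (t + 1)).F.support, cornerPot q m ≤ ∑ m ∈ (W.st (t + 1 + 1)).F.support, cornerPot q m := by
  rw [sum_cornerPot_succ W t hb hcard]
  exact Finset.sum_le_sum fun m hm => cornerPot_le_chartExponent q _ (le_degree_of_mem_support_succ W t hm)

/-- … and rises STRICTLY, because isolation of the top locus forces a `j_t`-light monomial. [folklore — new
here] [folklore] -/
theorem sum_cornerPot_lt_succ {q : ℕ} {s₀ : State (Fin 3) K} (W : ForcedWalk q s₀) (t : ℕ) (hb : W.b (t + 1) = 0)
    (hcard : (W.st (t + 1)).F.support.card ≤ (W.st (t + 1 + 1)).F.support.card) :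
    ∑ m ∈ (W.st (t + 1)).F.support, cornerPot q m < ∑ m ∈ (W.st (t + 1 + 1)).F.support, cornerPot q m := by
  have hnot : ¬ OffHeavy q (W.j (t + 1)) (W.st (t + 1)).F := fun h => not_isolatedTop_of_offHeavy h (W.isolated (t + 1))
  unfold OffHeavy at hnot
  push Not at hnot
  obtain ⟨m, hm, hlow⟩ := hnot
  rw [sum_cornerPot_succ W t hb hcard]
  exact Finset.sum_lt_sum (fun m hm => cornerPot_le_chartExponent q _ (le_degree_of_mem_support_succ W t hm))
    ⟨m, hm, cornerPot_lt_chartExponent q _ (le_degree_of_mem_support_succ W t hm) hlow⟩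

/-- The pumping clock is periodic: the second lap reads the same cycle indices as the first. [folklore] -/
theorem Lasso.clock_shift {q : ℕ} {s₀ : State (Fin 3) K} (L : Lasso q s₀) (k : ℕ) :
    L.clock (L.t₁ + k) = L.clock (L.t₀ + k) := by
  induction k with
  | zero =>
    obtain ⟨e, he⟩ : ∃ e, L.t₁ = e + 1 := ⟨L.t₁ - 1, by have := L.lt; omega⟩
    rw [Nat.add_zero, Nat.add_zero, L.clock_eq_self L.lt, he, Lasso.clock_succ, L.clock_eq_self (by omega), if_pos he.symm]
  | succ k ih => rw [← Nat.add_assoc, ← Nat.add_assoc, Lasso.clock_succ, Lasso.clock_succ, ih]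

/-- … so the pumped walk is periodic in time with period `t₁ − t₀` from `t₀` on. [folklore] -/
theorem Lasso.pump_st_shift {q : ℕ} {s₀ : State (Fin 3) K} (L : Lasso q s₀) (k : ℕ) :
    L.pump.st (L.t₁ + k) = L.pump.st (L.t₀ + k) := by
  rw [Lasso.pump_st, Lasso.pump_st, L.clock_shift]

/-- **NO CORNER LASSOS** (DECIDED, every `q`, every field, EVERY CHART WORD): the cycle of a lasso cannot consist of
corner steps only (`b_c = 0` for `t₀ ≤ c < t₁`, charts arbitrary).  Proof: pump; along the second lap the support
cardinalities are non-increasing and periodic, hence constant (no deletions); the corner-potential sum is then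
non-decreasing, strictly increasing at the first step (isolation ⇒ a light monomial), and periodic — absurd.  This
SUPERSEDES `no_cornerMonoChart_lasso` (one chart) and decides the whole corner sub-cell of `NoLassos`.
[DECIDED — PROVED here] (Sources: Hauser2010, §F.) -/
theorem no_corner_lasso {q : ℕ} {s₀ : State (Fin 3) K} (L : Lasso q s₀)
    (h : ∀ c, L.t₀ ≤ c → c < L.t₁ → L.run.b c = 0) : False := by
  classical
  have hb : ∀ t, L.t₀ ≤ t → L.pump.b t = 0 := fun t ht => h _ (L.le_clock ht) (L.clock_lt t)
  obtain ⟨e, he⟩ : ∃ e, L.t₁ = e + 1 := ⟨L.t₁ - 1, by have := L.lt; omega⟩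
  have hlt := L.lt
  -- the second lap: walk times `e + k + 1 = t₁ + k`, `k ≤ T := t₁ − t₀`
  have hbk : ∀ k, L.pump.b (e + k + 1) = 0 := fun k => hb _ (by omega)
  have hper : L.pump.st (e + (L.t₁ - L.t₀) + 1) = L.pump.st (e + 0 + 1) := by
    rw [show e + (L.t₁ - L.t₀) + 1 = L.t₁ + (L.t₁ - L.t₀) by omega, L.pump_st_shift,
      show L.t₀ + (L.t₁ - L.t₀) = e + 0 + 1 by omega]
  -- support cardinalities: antitone and periodic, hence constant
  have hmono : ∀ n k, (L.pump.st (e + (k + n) + 1)).F.support.card ≤ (L.pump.st (e + k + 1)).F.support.card := by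
    intro n
    induction n with
    | zero => intro k; exact le_rfl
    | succ n ih =>
      intro k
      have h1 := card_support_succ_le L.pump (e + (k + n)) (hbk (k + n))
      rw [show e + (k + n) + 1 + 1 = e + (k + (n + 1)) + 1 by omega] at h1
      exact h1.trans (ih k)
  have hceq : ∀ k, k < L.t₁ - L.t₀ →
      (L.pump.st (e + k + 1)).F.support.card ≤ (L.pump.st (e + k + 1 + 1)).F.support.card := by
    intro k hk
    have h1 := hmono k 0
    rw [Nat.zero_add] at h1
    have h2 := hmono (L.t₁ - L.t₀ - (k + 1)) (k + 1)
    rw [show k + 1 + (L.t₁ - L.t₀ - (k + 1)) = L.t₁ - L.t₀ by omega, hper] at h2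
    rw [show e + k + 1 + 1 = e + (k + 1) + 1 by omega]
    exact h1.trans h2
  -- the potential sums: non-decreasing along the lap, strictly increasing at its first step, periodic
  have hchain : ∀ n k, k + n ≤ L.t₁ - L.t₀ →
      ∑ m ∈ (L.pump.st (e + k + 1)).F.support, cornerPot q m ≤
        ∑ m ∈ (L.pump.st (e + (k + n) + 1)).F.support, cornerPot q m := by
    intro n
    induction n with
    | zero => intro k _; exact le_rfl
    | succ n ih =>
      intro k hk
      have h1 := sum_cornerPot_le_succ L.pump (e + (k + n)) (hbk (k + n)) (hceq (k + n) (by omega))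
      rw [show e + (k + n) + 1 + 1 = e + (k + (n + 1)) + 1 by omega] at h1
      exact (ih k (by omega)).trans h1
  have hfirst := sum_cornerPot_lt_succ L.pump (e + 0) (hbk 0) (hceq 0 (by omega))
  have hrest := hchain (L.t₁ - L.t₀ - 1) 1 (by omega)
  rw [show e + (1 + (L.t₁ - L.t₀ - 1)) + 1 = e + (L.t₁ - L.t₀) + 1 by omega, hper] at hrest
  rw [show e + 0 + 1 + 1 = e + 1 + 1 by omega] at hfirst
  exact absurd (lt_of_lt_of_le hfirst hrest) (lt_irrefl _)

/-- COROLLARY: the cycle of every lasso contains a TRANSLATION step (`b_c ≠ 0`): a divergent forced walk, if one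
exists, can never settle into corner points of the exceptional configuration with a periodic state.
[DECIDED — PROVED here] (Sources: Hauser2010, §F.) -/
theorem Lasso.exists_translation_step {q : ℕ} {s₀ : State (Fin 3) K} (L : Lasso q s₀) :
    ∃ c, L.t₀ ≤ c ∧ c < L.t₁ ∧ L.run.b c ≠ 0 := by
  by_contra hne
  push Not at hne
  exact no_corner_lasso L hne

/-- The TAIL of an infinite forced walk from time `T₀` is an infinite forced walk from the state `s_{T₀}`. [folklore] -/
def shiftWalk {q : ℕ} {s₀ : State (Fin 3) K} (W : ForcedWalk q s₀) (T₀ : ℕ) : ForcedWalk q (W.st T₀) where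
  j t := W.j (T₀ + t)
  b t := W.b (T₀ + t)
  st t := W.st (T₀ + t)
  st_zero := rfl
  st_succ t := W.st_succ (T₀ + t)
  onExc t := W.onExc (T₀ + t)
  equimult t := W.equimult (T₀ + t)
  isolated t := W.isolated (T₀ + t)

/-- **CORNER TAILS ESCAPE** (finite ground field): an infinite forced walk whose recipe is eventually all-corner
(`b_t = 0` for `t ≥ T₀`, charts arbitrary) leaves every complexity box — a bounded one would revisit a state inside the
tail (pigeonhole, `exists_repeat_of_bounded`) and exhibit a corner lasso.  So inside the located residual
`NoEscapingWalks` nothing more can hide at the corners: a bounded divergent witness translates in every period.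
[DECIDED — PROVED here] (Sources: Hauser2010, §F.) -/
theorem corner_tail_escapes [Fintype K] {q : ℕ} {s₀ : State (Fin 3) K} (W : ForcedWalk q s₀) (T₀ : ℕ)
    (hrec : ∀ t, T₀ ≤ t → W.b t = 0) (D : ℕ) : ∃ t, D < cx (W.st t) := by
  by_contra h
  push Not at h
  obtain ⟨t₀, t₁, hlt, heq⟩ := exists_repeat_of_bounded (shiftWalk W T₀) (fun t => h (T₀ + t))
  exact no_corner_lasso (lassoOf (shiftWalk W T₀) hlt heq) fun c _ _ => hrec (T₀ + c) (Nat.le_add_right _ _)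


/-! ### §4c NO TWO-CHART CORNER TAILS — the product potential `π = ρ_J · ρ_K` (engine:
`CornerTowerDescent.two_letter_descent`)

If a corner segment uses only TWO charts `J, K` (the third exceptional component is never the chart again), the
two off-balances `ρ_J = off_J − q`, `ρ_K = off_K − q` of a monomial evolve ALONE — a `J`-play adds `ρ_J` to `ρ_K`, a
`K`-play adds `ρ_K` to `ρ_J` (the parabolic generators of `SL₂(ℤ)`), and the product `π = ρ_J ρ_K` rises by the square
of the played balance.  A DOUBLY LIGHT monomial (`ρ_J, ρ_K < 0`) would stay doubly light and lose degree at every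
step — impossible — so the isolation witness of each step (`ρ_played ≤ −1`) has `ρ_other ≥ −ρ_played ≥ 1`, i.e.
`π ≤ −1`, and its `π` rises by `≥ 1` while staying `≤ 0`.  Hence the NEGATIVE PART `Σ_{supp} π⁻ ∈
ℕ` drops at every
step: an infinite two-chart corner tail does not exist (any `q`, any field; deletions only help).  The abstract descent
lemma is `Theorems.CornerTowerDescent.two_letter_descent` (landed separately, where it also proves the TREE leaves
`MonomialTowerClasses.NoCornerTower d n`, `d ≤ 3`); here it is instantiated on the E-model (`no_twoChart_corner_tail`,
superseding `no_axis_tail`; `corner_tail_uses_all_charts` = the RESIDUAL SHAPE of a corner tail). -/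

/-- **NO TWO-CHART CORNER TAILS** (DECIDED, every `q`, every field): an infinite forced walk cannot, from some time
on, pass through corner points only (`b = 0`) while avoiding one chart `u_l` (i.e. using at most two charts).
SUPERSEDES `no_axis_tail` (one chart).  [DECIDED — PROVED here, by `two_letter_descent`] (Sources: Hauser2010, §F.) -/
theorem no_twoChart_corner_tail {q : ℕ} {s₀ : State (Fin 3) K} (W : ForcedWalk q s₀) (l : Fin 3) (T₀ : ℕ)
    (hrec : ∀ t, T₀ ≤ t → W.b (t + 1) = 0 ∧ W.j (t + 1) ≠ l) : False := by
  classical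
  refine two_letter_descent (A := Fin 3 →₀ ℕ) (L := Fin 3) q (fun m => m.degree) (fun k m => m.degree - m k)
    (fun i => (W.st (T₀ + i + 1)).F.support) (fun i => chartExponent q (W.j (T₀ + i + 1)))
    (fun i => W.j (T₀ + i + 1)) (l + 1) (l + 2) (fin3_succ_ne_succ_succ l)
    (fun i => fin3_eq_or_of_ne l _ (hrec (T₀ + i) (Nat.le_add_right _ _)).2)
    (fun i m => offDegree_chartExponent q _ m) ?_ ?_ ?_ ?_ ?_ ?_
  · intro i m k hk hq
    rw [degree_chartExponent, chartExponent_apply, if_neg hk]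
    have h1 := apply_le_degree_sub hk m
    have h2 : m (W.j (T₀ + i + 1)) ≤ m.degree := by
      rw [degree_eq_add_sum_erase (W.j (T₀ + i + 1)) m]; exact Nat.le_add_right _ _
    omega
  · intro i m hq
    rw [degree_chartExponent]
    have h2 : m (W.j (T₀ + i + 1)) ≤ m.degree := by
      rw [degree_eq_add_sum_erase (W.j (T₀ + i + 1)) m]; exact Nat.le_add_right _ _
    omega
  · intro i
    exact support_succ_subset_image W (T₀ + i) (hrec (T₀ + i) (Nat.le_add_right _ _)).1
  · intro i m hm hlow
    exact (low_monomial_transport W rfl (hrec (T₀ + i) (Nat.le_add_right _ _)).1 hm hlow).1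
  · intro i m hm
    exact le_degree_of_mem_support_succ W (T₀ + i) hm
  · intro i
    have hnot : ¬ OffHeavy q (W.j (T₀ + i + 1)) (W.st (T₀ + i + 1)).F :=
      fun h => not_isolatedTop_of_offHeavy h (W.isolated (T₀ + i + 1))
    unfold OffHeavy at hnot
    push Not at hnot
    exact hnot

omit [Field K] [DecidableEq K] in
/-- pure arithmetic. [folklore] -/
theorem fin3_self_ne_succ : ∀ j : Fin 3, j ≠ j + 1 := by decide

/-- **RESIDUAL SHAPE OF A CORNER TAIL** (DECIDED): if an infinite forced walk passes, from time `T₀` on, through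
corner points only, then EVERY chart recurs — all three exceptional components are «the chart» infinitely often.
Together with `no_corner_lasso` (no state repeats) and `corner_tail_escapes` (finite field: every complexity box is
left) this is what remains of the corner cell of `NoAperiodicWalks`. [DECIDED — PROVED here] [folklore] -/
theorem corner_tail_uses_all_charts {q : ℕ} {s₀ : State (Fin 3) K} (W : ForcedWalk q s₀) (T₀ : ℕ)
    (hrec : ∀ t, T₀ ≤ t → W.b (t + 1) = 0) (l : Fin 3) (T : ℕ) : ∃ t, T ≤ t ∧ W.j (t + 1) = l := by
  by_contra h
  push Not at h
  exact no_twoChart_corner_tail W l (max T₀ T) fun t ht =>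
    ⟨hrec t (le_trans (le_max_left _ _) ht), h t (le_trans (le_max_right _ _) ht)⟩


end CornerTails

end Summit.ResolutionOfSingularities.ResolutionOfSingularities.Theorems.LassoCut
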